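import Mathlib
import Literature.Analysis.FluidPDE.SuitableWeak
import Literature.Analysis.FluidPDE.WeakSolutionProofs
import Literature.Analysis.FluidPDE.RusinSverakLeraySolutionsProofs
import HarnessLib

/-!
# Crux `EulerZoomLiouville.PowerGaugeEulerLiouville` (stmt-NavierStokesRegularity-19832):
# THE PRESSURE-SWAP LEMMA — membership in Seregin's power-gauged class is invariant under changing the pressure on null sets

Route №10 `EulerZoomLiouville` (NavierStokesRegularity), crux E.  LEAD ns-typeII-p2 g11's «pressure slaving» key (cell STATUS
10:21:09Z (4) / 10:28:47Z (a)), second half: the SWAP LEMMA `InClass ρ u p H c → (∀ τ<0, p τ =ᵐ p' τ) → InClass ρ u p' H c`, which lets the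
skeleton replace a member's pressure by any slice-wise a.e.-equal representative (e.g. the self-similar ansatz form of a slaved pressure)
without leaving the class.  The class hypotheses see the pressure only through: local integrability on the slab and the distributional
momentum identity (product-measure integrals over the slab: `IsDistributionalNSSolutionOn`), the local `L^{3/2}` bound and the local
energy inequality of `IsSuitableWeakSolutionOn` (the latter an iterated `∫ dt ∫ dx` against test functions vanishing for `t ≥ 0`), and the
scaled pressure gauge `cknD` (a product-measure integral over parabolic cylinders inside the slab) — all of which are blind to a
product-null change of `p`.  A slice-wise null change is a product-null change as soon as the new pressure is (a.e.-strongly) measurable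
on the slab (Tonelli; the tree's `ae_prod_of_forall_ae_slice`), which is the one extra hypothesis.

* `ae_eq_slab_of_forall_ae_eq_slice` — slice-wise `p' τ =ᵐ p τ` (`τ < 0`) + measurability ⇒ `p' =ᵐ p` on the slab (product measure);
* `isDistributionalNSSolutionOn_congr_pressure` — the distributional Navier–Stokes/Euler identity on any open `Q` survives a
  `volume.restrict Q`-a.e. change of the pressure;
* `isSuitableWeakSolutionOn_slab_congr_pressure` — so does suitability on the slab `(−∞,0) × ℝ³` (local `L^{3/2}`, local energy inequality);
* `cknD_congr_pressure` — and the scaled pressure gauge at the origin;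
* **`inClass_congr_pressure`** — the swap lemma in the crux's binder shape (`InClass` δ-unfolded), slice hypothesis for every `τ < 0`;
* **`inClass_congr_pressure_ae`** / `inClass_congr_pressure_of_ae_slice` (appended) — the same from the PRODUCT-measure form
  `p' =ᵐ p` on the slab (no measurability binder) / from the slice form for a.e. `τ < 0`; `ae_eq_slab_of_ae_ae_eq_slice`,
  `ae_ae_eq_slice_of_ae_eq_slab`, `isSuitableWeakSolutionOn_slab_congr_pressure_ae`.

WHAT THIS IS NOT: not NS, not the crux, and not the slaving theorem itself (the identification of a member's pressure with the scale-wise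
Riesz pressure of its self-similar velocity is the other, L-sized half of the key) — measure-theoretic bookkeeping `--supports` stmt-19832.
[cite: CaffarelliKohnNirenberg1982, §2 (2.1)–(2.5) (the class); folklore (Tonelli)]
-/

noncomputable section

-- flat `Theorems/<Route><Decl>…` files of one crux share the namespace of the crux (tree convention)
set_option linter.dupNamespace false

open MeasureTheory Set Filter Topology Metric Function
open scoped NNReal ENNReal RealInnerProductSpace Laplacian

namespace Summit.NavierStokesRegularity.NavierStokesRegularity.Theorems.PowerGaugeEulerLiouville.PressureSwap

open Literature.Analysis Literature.Analysis.FluidPDE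

/-! ### Slice-wise null changes are product-null changes -/

/-- **Slice-wise a.e. equality ⇒ a.e. equality on the slab.**  If `p`, `p'` are a.e.-strongly measurable on the slab `(−∞,0) × ℝ³` and
`p' τ = p τ` a.e. for every `τ < 0`, then `p' = p` a.e. on the slab (product Lebesgue measure). [folklore] -/
theorem ae_eq_slab_of_forall_ae_eq_slice {p p' : ℝ → EuclideanSpace ℝ (Fin 3) → ℝ}
    (hp : AEStronglyMeasurable (uncurry p) (volume.restrict (Iio (0 : ℝ) ×ˢ (univ : Set (EuclideanSpace ℝ (Fin 3))))))
    (hp' : AEStronglyMeasurable (uncurry p') (volume.restrict (Iio (0 : ℝ) ×ˢ (univ : Set (EuclideanSpace ℝ (Fin 3))))))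
    (h : ∀ τ : ℝ, τ < 0 → p' τ =ᵐ[volume] p τ) :
    uncurry p' =ᵐ[volume.restrict (Iio (0 : ℝ) ×ˢ (univ : Set (EuclideanSpace ℝ (Fin 3))))] uncurry p := by
  have hμ : (volume.restrict (Iio (0 : ℝ) ×ˢ (univ : Set (EuclideanSpace ℝ (Fin 3))))) =
      ((volume : Measure ℝ).restrict (Iio 0)).prod (volume : Measure (EuclideanSpace ℝ (Fin 3))) := by
    rw [Measure.volume_eq_prod, ← Measure.prod_restrict, Measure.restrict_univ]
  rw [hμ] at hp hp' ⊢
  have hd : AEStronglyMeasurable (fun z => uncurry p' z - uncurry p z)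
      (((volume : Measure ℝ).restrict (Iio 0)).prod (volume : Measure (EuclideanSpace ℝ (Fin 3)))) := hp'.sub hp
  have hb := ae_prod_of_forall_ae_slice (μ := (volume : Measure (EuclideanSpace ℝ (Fin 3)))) measurableSet_Iio hd
    (g := fun _ => (0 : ℝ)) measurable_const fun t ht => by
      filter_upwards [h t ht] with x hx
      simp [uncurry, hx]
  filter_upwards [hb] with z hz
  have : ‖uncurry p' z - uncurry p z‖ ≤ 0 := hz
  exact sub_eq_zero.1 (norm_le_zero_iff.1 this)

/-! ### The distributional identity -/

variable {ν : ℝ} {f u : ℝ → EuclideanSpace ℝ (Fin 3) → EuclideanSpace ℝ (Fin 3)} {p p' : ℝ → EuclideanSpace ℝ (Fin 3) → ℝ}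

/-- **The distributional Navier–Stokes/Euler identity survives an a.e. change of the pressure** on any open space–time region. [folklore] -/
theorem isDistributionalNSSolutionOn_congr_pressure {Q : TopologicalSpace.Opens (ℝ × EuclideanSpace ℝ (Fin 3))}
    (h : IsDistributionalNSSolutionOn Q ν f u p)
    (hpp : uncurry p' =ᵐ[volume.restrict (Q : Set (ℝ × EuclideanSpace ℝ (Fin 3)))] uncurry p) :
    IsDistributionalNSSolutionOn Q ν f u p' := by
  obtain ⟨hu, hu2, hpl, hdiv, hmom⟩ := h
  refine ⟨hu, hu2, (locallyIntegrableOn_congr hpp).2 hpl, hdiv, fun ψ hψ => ?_⟩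
  rw [← hmom ψ hψ]
  refine integral_congr_ae ?_
  filter_upwards [hpp] with z hz
  have hz' : p' z.1 z.2 = p z.1 z.2 := hz
  rw [hz']

/-! ### Suitability on the slab -/

/-- **Suitability on the slab `(−∞,0) × ℝ³` survives a slice-wise a.e. change of the pressure** (given measurability of the new pressure
on the slab): the local `L^{3/2}` bound and the distributional identity are product-measure statements, the local energy inequality is an
iterated integral against test functions whose slices vanish for `t ≥ 0`. [cite: CaffarelliKohnNirenberg1982, §2 (2.1)–(2.5)] -/
theorem isSuitableWeakSolutionOn_slab_congr_pressure
    (h : IsSuitableWeakSolutionOn (slab (EuclideanSpace ℝ (Fin 3)) (Iio 0) isOpen_Iio) ν f u p)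
    (hpp : uncurry p' =ᵐ[volume.restrict (Iio (0 : ℝ) ×ˢ (univ : Set (EuclideanSpace ℝ (Fin 3))))] uncurry p)
    (hsl : ∀ τ : ℝ, τ < 0 → p' τ =ᵐ[volume] p τ) :
    IsSuitableWeakSolutionOn (slab (EuclideanSpace ℝ (Fin 3)) (Iio 0) isOpen_Iio) ν f u p' := by
  have hQ : ((slab (EuclideanSpace ℝ (Fin 3)) (Iio 0) isOpen_Iio : TopologicalSpace.Opens (ℝ × EuclideanSpace ℝ (Fin 3))) :
      Set (ℝ × EuclideanSpace ℝ (Fin 3))) = Iio (0 : ℝ) ×ˢ univ := coe_slab _ _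
  refine ⟨?_, h.energyClass, fun K hK hKc => ?_, ?_⟩
  · -- the distributional identity
    refine isDistributionalNSSolutionOn_congr_pressure h.distributional ?_
    rw [hQ]; exact hpp
  · -- the local `L^{3/2}` bound on compacts `K ⊆ slab`
    have hK' : K ⊆ Iio (0 : ℝ) ×ˢ univ := by rwa [hQ] at hK
    have hae : ∀ᵐ z ∂(volume.restrict K), ‖p' z.1 z.2‖ₑ ^ (3 / 2 : ℝ) = ‖p z.1 z.2‖ₑ ^ (3 / 2 : ℝ) := by
      filter_upwards [ae_restrict_of_ae_restrict_of_subset hK' hpp] with z hz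
      have hz' : p' z.1 z.2 = p z.1 z.2 := hz
      rw [hz']
    rw [lintegral_congr_ae hae]
    exact h.pressure K hK hKc
  · -- the local energy inequality (same weak gradient)
    obtain ⟨G, hG, hGint, hLEI⟩ := h.localEnergy
    refine ⟨G, hG, hGint, fun φ hφ hφ0 => ?_⟩
    have key : (∫ t, ∫ x, (‖u t x‖ ^ 2 * (timeDeriv φ t x + ν * Δ (φ t) x) +
          (‖u t x‖ ^ 2 + 2 * p' t x) * ⟪u t x, gradient (φ t) x⟫ + 2 * ⟪f t x, u t x⟫ * φ t x)) =
        ∫ t, ∫ x, (‖u t x‖ ^ 2 * (timeDeriv φ t x + ν * Δ (φ t) x) +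
          (‖u t x‖ ^ 2 + 2 * p t x) * ⟪u t x, gradient (φ t) x⟫ + 2 * ⟪f t x, u t x⟫ * φ t x) := by
      refine integral_congr_ae (Eventually.of_forall fun t => ?_)
      by_cases ht : t < 0
      · refine integral_congr_ae ?_
        filter_upwards [hsl t ht] with x hx
        rw [hx]
      · -- for `t ≥ 0` the slice `φ t` vanishes identically, so the pressure term is absent
        have hφt : φ t = 0 := hφ.slice_eq_zero ht
        refine integral_congr_ae (Eventually.of_forall fun x => ?_)
        have hg : gradient (φ t) x = 0 := by
          rw [hφt]
          exact gradient_fun_const x 0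
        simp only [hg, inner_zero_right, mul_zero]
    rw [key]
    exact hLEI φ hφ hφ0

/-! ### The scaled pressure gauge -/

/-- **The scaled pressure gauge at the origin is blind to an a.e. change of the pressure on the slab** (`0 < a`). [folklore] -/
theorem cknD_congr_pressure
    (hpp : uncurry p' =ᵐ[volume.restrict (Iio (0 : ℝ) ×ˢ (univ : Set (EuclideanSpace ℝ (Fin 3))))] uncurry p) (a : ℝ) :
    cknD a (0 : ℝ × EuclideanSpace ℝ (Fin 3)) p' = cknD a (0 : ℝ × EuclideanSpace ℝ (Fin 3)) p := by
  unfold cknD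
  congr 1
  have hsub : parabolicCylinder a (0 : ℝ × EuclideanSpace ℝ (Fin 3)) ⊆ Iio (0 : ℝ) ×ˢ univ := by
    intro z hz
    exact ⟨hz.1.2, mem_univ _⟩
  refine lintegral_congr_ae ?_
  filter_upwards [ae_restrict_of_ae_restrict_of_subset hsub hpp] with z hz
  have hz' : p' z.1 z.2 = p z.1 z.2 := hz
  rw [hz']

/-! ### The swap lemma in the crux's binder shape -/

/-- **THE PRESSURE-SWAP LEMMA** (`InClass ρ u p H c → (∀ τ<0, p' τ =ᵐ p τ) → InClass ρ u p' H c`, `InClass` δ-unfolded; the new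
pressure is assumed a.e.-strongly measurable on the slab): membership in Seregin's power-gauged ancient class — suitable weak solution of
Euler on `(−∞,0) × ℝ³`, weak spatial gradient `H`, and the three power gauges `a^{2ρ}A(a) + a^ρ E(a) + a^{2ρ} D(a) ≤ c` — is unchanged
when the pressure is modified on a null set of every slice. [cite: CaffarelliKohnNirenberg1982, §2 (2.1)–(2.5)] -/
theorem inClass_congr_pressure {ρ : ℝ} {H : ℝ → EuclideanSpace ℝ (Fin 3) → EuclideanSpace ℝ (Fin 3) →L[ℝ] EuclideanSpace ℝ (Fin 3)}
    {c : ℝ≥0}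
    (hcls : IsSuitableWeakSolutionOn (slab (EuclideanSpace ℝ (Fin 3)) (Set.Iio 0) isOpen_Iio) 0 0 u p ∧
      HasWeakSpatialGradientOn (slab (EuclideanSpace ℝ (Fin 3)) (Set.Iio 0) isOpen_Iio) u H ∧
      (∀ a : ℝ, 0 < a →
        ENNReal.ofReal (a ^ (2 * ρ)) * cknA a (0 : ℝ × EuclideanSpace ℝ (Fin 3)) u +
              ENNReal.ofReal (a ^ ρ) * cknE a (0 : ℝ × EuclideanSpace ℝ (Fin 3)) H +
            ENNReal.ofReal (a ^ (2 * ρ)) * cknD a (0 : ℝ × EuclideanSpace ℝ (Fin 3)) p ≤ (c : ℝ≥0∞)))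
    (hp'm : AEStronglyMeasurable (uncurry p') (volume.restrict (Iio (0 : ℝ) ×ˢ (univ : Set (EuclideanSpace ℝ (Fin 3))))))
    (hsl : ∀ τ : ℝ, τ < 0 → p' τ =ᵐ[volume] p τ) :
    IsSuitableWeakSolutionOn (slab (EuclideanSpace ℝ (Fin 3)) (Set.Iio 0) isOpen_Iio) 0 0 u p' ∧
      HasWeakSpatialGradientOn (slab (EuclideanSpace ℝ (Fin 3)) (Set.Iio 0) isOpen_Iio) u H ∧
      (∀ a : ℝ, 0 < a →
        ENNReal.ofReal (a ^ (2 * ρ)) * cknA a (0 : ℝ × EuclideanSpace ℝ (Fin 3)) u +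
              ENNReal.ofReal (a ^ ρ) * cknE a (0 : ℝ × EuclideanSpace ℝ (Fin 3)) H +
            ENNReal.ofReal (a ^ (2 * ρ)) * cknD a (0 : ℝ × EuclideanSpace ℝ (Fin 3)) p' ≤ (c : ℝ≥0∞)) := by
  obtain ⟨hsw, hH, hgauge⟩ := hcls
  -- the old pressure is measurable on the slab (it is locally integrable there)
  have hQ : ((slab (EuclideanSpace ℝ (Fin 3)) (Iio 0) isOpen_Iio : TopologicalSpace.Opens (ℝ × EuclideanSpace ℝ (Fin 3))) :
      Set (ℝ × EuclideanSpace ℝ (Fin 3))) = Iio (0 : ℝ) ×ˢ univ := coe_slab _ _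
  have hpm : AEStronglyMeasurable (uncurry p) (volume.restrict (Iio (0 : ℝ) ×ˢ (univ : Set (EuclideanSpace ℝ (Fin 3))))) := by
    have h := hsw.distributional.2.2.1.aestronglyMeasurable
    rwa [hQ] at h
  have hpp := ae_eq_slab_of_forall_ae_eq_slice hpm hp'm hsl
  refine ⟨isSuitableWeakSolutionOn_slab_congr_pressure hsw hpp hsl, hH, fun a ha => ?_⟩
  rw [cknD_congr_pressure hpp a]
  exact hgauge a ha

/-! ### A.e.-in-time versions (appended 2026-08-28, on the slaving-theorem owner's request: an identification of the pressure can only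
hold for a.e. `τ`, so the swap must consume the PRODUCT-measure form `p' = p` a.e. on the slab — no measurability binder is then needed) -/

/-- **A.e.-slice-wise a.e. equality ⇒ a.e. equality on the slab**: as `ae_eq_slab_of_forall_ae_eq_slice`, with the slice hypothesis only
for a.e. `τ < 0`. [folklore] -/
theorem ae_eq_slab_of_ae_ae_eq_slice {p p' : ℝ → EuclideanSpace ℝ (Fin 3) → ℝ}
    (hp : AEStronglyMeasurable (uncurry p) (volume.restrict (Iio (0 : ℝ) ×ˢ (univ : Set (EuclideanSpace ℝ (Fin 3))))))
    (hp' : AEStronglyMeasurable (uncurry p') (volume.restrict (Iio (0 : ℝ) ×ˢ (univ : Set (EuclideanSpace ℝ (Fin 3))))))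
    (h : ∀ᵐ τ : ℝ ∂(volume.restrict (Iio 0)), p' τ =ᵐ[volume] p τ) :
    uncurry p' =ᵐ[volume.restrict (Iio (0 : ℝ) ×ˢ (univ : Set (EuclideanSpace ℝ (Fin 3))))] uncurry p := by
  have hμ : (volume.restrict (Iio (0 : ℝ) ×ˢ (univ : Set (EuclideanSpace ℝ (Fin 3))))) =
      ((volume : Measure ℝ).restrict (Iio 0)).prod (volume : Measure (EuclideanSpace ℝ (Fin 3))) := by
    rw [Measure.volume_eq_prod, ← Measure.prod_restrict, Measure.restrict_univ]
  rw [hμ] at hp hp' ⊢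
  -- strongly measurable representative of the difference
  have hd : AEStronglyMeasurable (fun z => uncurry p' z - uncurry p z)
      (((volume : Measure ℝ).restrict (Iio 0)).prod (volume : Measure (EuclideanSpace ℝ (Fin 3)))) := hp'.sub hp
  set w := hd.mk _ with hw
  have hwm : StronglyMeasurable w := hd.stronglyMeasurable_mk
  have hdw : (fun z => uncurry p' z - uncurry p z) =ᵐ[((volume : Measure ℝ).restrict (Iio 0)).prod volume] w := hd.ae_eq_mk
  have hset : MeasurableSet {z : ℝ × EuclideanSpace ℝ (Fin 3) | w z = 0} := hwm.measurable (measurableSet_singleton 0)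
  have hslice : ∀ᵐ t ∂((volume : Measure ℝ).restrict (Iio 0)), ∀ᵐ x ∂(volume : Measure (EuclideanSpace ℝ (Fin 3))),
      w (t, x) = 0 := by
    filter_upwards [Measure.ae_ae_of_ae_prod hdw, h] with t ht hpt
    filter_upwards [ht, hpt] with x hx hpx
    rw [← hx]
    simp [uncurry, hpx]
  have hw0 : ∀ᵐ z ∂(((volume : Measure ℝ).restrict (Iio 0)).prod (volume : Measure (EuclideanSpace ℝ (Fin 3)))), w z = 0 :=
    (Measure.ae_prod_iff_ae_ae (μ := (volume : Measure ℝ).restrict (Iio 0))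
      (ν := (volume : Measure (EuclideanSpace ℝ (Fin 3)))) hset).2 hslice
  filter_upwards [hw0, hdw] with z hz hzd
  have : uncurry p' z - uncurry p z = 0 := by rw [hzd, hz]
  exact sub_eq_zero.1 this

/-- From a.e. equality on the slab to a.e.-in-time slice-wise a.e. equality (Tonelli, `Measure.ae_ae_of_ae_prod`). [folklore] -/
theorem ae_ae_eq_slice_of_ae_eq_slab {p p' : ℝ → EuclideanSpace ℝ (Fin 3) → ℝ}
    (hpp : uncurry p' =ᵐ[volume.restrict (Iio (0 : ℝ) ×ˢ (univ : Set (EuclideanSpace ℝ (Fin 3))))] uncurry p) :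
    ∀ᵐ τ : ℝ ∂volume, τ < 0 → p' τ =ᵐ[volume] p τ := by
  have hμ : (volume.restrict (Iio (0 : ℝ) ×ˢ (univ : Set (EuclideanSpace ℝ (Fin 3))))) =
      ((volume : Measure ℝ).restrict (Iio 0)).prod (volume : Measure (EuclideanSpace ℝ (Fin 3))) := by
    rw [Measure.volume_eq_prod, ← Measure.prod_restrict, Measure.restrict_univ]
  rw [hμ] at hpp
  have h1 : ∀ᵐ τ : ℝ ∂((volume : Measure ℝ).restrict (Iio 0)), p' τ =ᵐ[volume] p τ := by
    filter_upwards [Measure.ae_ae_of_ae_prod hpp] with t ht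
    filter_upwards [ht] with x hx
    exact hx
  rw [ae_restrict_iff' measurableSet_Iio] at h1
  filter_upwards [h1] with t ht hlt
  exact ht hlt

/-- **Suitability on the slab survives an a.e. change of the pressure (product form).** [cite: CaffarelliKohnNirenberg1982, §2 (2.1)–(2.5)] -/
theorem isSuitableWeakSolutionOn_slab_congr_pressure_ae
    (h : IsSuitableWeakSolutionOn (slab (EuclideanSpace ℝ (Fin 3)) (Iio 0) isOpen_Iio) ν f u p)
    (hpp : uncurry p' =ᵐ[volume.restrict (Iio (0 : ℝ) ×ˢ (univ : Set (EuclideanSpace ℝ (Fin 3))))] uncurry p) :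
    IsSuitableWeakSolutionOn (slab (EuclideanSpace ℝ (Fin 3)) (Iio 0) isOpen_Iio) ν f u p' := by
  have hQ : ((slab (EuclideanSpace ℝ (Fin 3)) (Iio 0) isOpen_Iio : TopologicalSpace.Opens (ℝ × EuclideanSpace ℝ (Fin 3))) :
      Set (ℝ × EuclideanSpace ℝ (Fin 3))) = Iio (0 : ℝ) ×ˢ univ := coe_slab _ _
  have hsl := ae_ae_eq_slice_of_ae_eq_slab hpp
  refine ⟨?_, h.energyClass, fun K hK hKc => ?_, ?_⟩
  · refine isDistributionalNSSolutionOn_congr_pressure h.distributional ?_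
    rw [hQ]; exact hpp
  · have hK' : K ⊆ Iio (0 : ℝ) ×ˢ univ := by rwa [hQ] at hK
    have hae : ∀ᵐ z ∂(volume.restrict K), ‖p' z.1 z.2‖ₑ ^ (3 / 2 : ℝ) = ‖p z.1 z.2‖ₑ ^ (3 / 2 : ℝ) := by
      filter_upwards [ae_restrict_of_ae_restrict_of_subset hK' hpp] with z hz
      have hz' : p' z.1 z.2 = p z.1 z.2 := hz
      rw [hz']
    rw [lintegral_congr_ae hae]
    exact h.pressure K hK hKc
  · obtain ⟨G, hG, hGint, hLEI⟩ := h.localEnergy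
    refine ⟨G, hG, hGint, fun φ hφ hφ0 => ?_⟩
    have key : (∫ t, ∫ x, (‖u t x‖ ^ 2 * (timeDeriv φ t x + ν * Δ (φ t) x) +
          (‖u t x‖ ^ 2 + 2 * p' t x) * ⟪u t x, gradient (φ t) x⟫ + 2 * ⟪f t x, u t x⟫ * φ t x)) =
        ∫ t, ∫ x, (‖u t x‖ ^ 2 * (timeDeriv φ t x + ν * Δ (φ t) x) +
          (‖u t x‖ ^ 2 + 2 * p t x) * ⟪u t x, gradient (φ t) x⟫ + 2 * ⟪f t x, u t x⟫ * φ t x) := by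
      refine integral_congr_ae ?_
      filter_upwards [hsl] with t hslt
      by_cases ht : t < 0
      · refine integral_congr_ae ?_
        filter_upwards [hslt ht] with x hx
        rw [hx]
      · have hφt : φ t = 0 := hφ.slice_eq_zero ht
        refine integral_congr_ae (Eventually.of_forall fun x => ?_)
        have hg : gradient (φ t) x = 0 := by
          rw [hφt]
          exact gradient_fun_const x 0
        simp only [hg, inner_zero_right, mul_zero]
    rw [key]
    exact hLEI φ hφ hφ0

/-- **THE PRESSURE-SWAP LEMMA, product form** (what a slice-wise-a.e.-in-time identification of the pressure can feed): membership in the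
power-gauged class (`InClass` δ-unfolded) is unchanged when the pressure is replaced by any `p'` with `p' = p` a.e. on the slab
`(−∞,0) × ℝ³` for the product Lebesgue measure — no separate measurability binder. [cite: CaffarelliKohnNirenberg1982, §2 (2.1)–(2.5)] -/
theorem inClass_congr_pressure_ae {ρ : ℝ} {H : ℝ → EuclideanSpace ℝ (Fin 3) → EuclideanSpace ℝ (Fin 3) →L[ℝ] EuclideanSpace ℝ (Fin 3)}
    {c : ℝ≥0}
    (hcls : IsSuitableWeakSolutionOn (slab (EuclideanSpace ℝ (Fin 3)) (Set.Iio 0) isOpen_Iio) 0 0 u p ∧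
      HasWeakSpatialGradientOn (slab (EuclideanSpace ℝ (Fin 3)) (Set.Iio 0) isOpen_Iio) u H ∧
      (∀ a : ℝ, 0 < a →
        ENNReal.ofReal (a ^ (2 * ρ)) * cknA a (0 : ℝ × EuclideanSpace ℝ (Fin 3)) u +
              ENNReal.ofReal (a ^ ρ) * cknE a (0 : ℝ × EuclideanSpace ℝ (Fin 3)) H +
            ENNReal.ofReal (a ^ (2 * ρ)) * cknD a (0 : ℝ × EuclideanSpace ℝ (Fin 3)) p ≤ (c : ℝ≥0∞)))
    (hpp : uncurry p' =ᵐ[volume.restrict (Iio (0 : ℝ) ×ˢ (univ : Set (EuclideanSpace ℝ (Fin 3))))] uncurry p) :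
    IsSuitableWeakSolutionOn (slab (EuclideanSpace ℝ (Fin 3)) (Set.Iio 0) isOpen_Iio) 0 0 u p' ∧
      HasWeakSpatialGradientOn (slab (EuclideanSpace ℝ (Fin 3)) (Set.Iio 0) isOpen_Iio) u H ∧
      (∀ a : ℝ, 0 < a →
        ENNReal.ofReal (a ^ (2 * ρ)) * cknA a (0 : ℝ × EuclideanSpace ℝ (Fin 3)) u +
              ENNReal.ofReal (a ^ ρ) * cknE a (0 : ℝ × EuclideanSpace ℝ (Fin 3)) H +
            ENNReal.ofReal (a ^ (2 * ρ)) * cknD a (0 : ℝ × EuclideanSpace ℝ (Fin 3)) p' ≤ (c : ℝ≥0∞)) := by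
  obtain ⟨hsw, hH, hgauge⟩ := hcls
  refine ⟨isSuitableWeakSolutionOn_slab_congr_pressure_ae hsw hpp, hH, fun a ha => ?_⟩
  rw [cknD_congr_pressure hpp a]
  exact hgauge a ha

/-- **THE PRESSURE-SWAP LEMMA, a.e.-in-time slice form**: as `inClass_congr_pressure` with the slice hypothesis only for a.e. `τ < 0`
(the new pressure a.e.-strongly measurable on the slab). [cite: CaffarelliKohnNirenberg1982, §2 (2.1)–(2.5)] -/
theorem inClass_congr_pressure_of_ae_slice {ρ : ℝ}
    {H : ℝ → EuclideanSpace ℝ (Fin 3) → EuclideanSpace ℝ (Fin 3) →L[ℝ] EuclideanSpace ℝ (Fin 3)} {c : ℝ≥0}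
    (hcls : IsSuitableWeakSolutionOn (slab (EuclideanSpace ℝ (Fin 3)) (Set.Iio 0) isOpen_Iio) 0 0 u p ∧
      HasWeakSpatialGradientOn (slab (EuclideanSpace ℝ (Fin 3)) (Set.Iio 0) isOpen_Iio) u H ∧
      (∀ a : ℝ, 0 < a →
        ENNReal.ofReal (a ^ (2 * ρ)) * cknA a (0 : ℝ × EuclideanSpace ℝ (Fin 3)) u +
              ENNReal.ofReal (a ^ ρ) * cknE a (0 : ℝ × EuclideanSpace ℝ (Fin 3)) H +
            ENNReal.ofReal (a ^ (2 * ρ)) * cknD a (0 : ℝ × EuclideanSpace ℝ (Fin 3)) p ≤ (c : ℝ≥0∞)))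
    (hp'm : AEStronglyMeasurable (uncurry p') (volume.restrict (Iio (0 : ℝ) ×ˢ (univ : Set (EuclideanSpace ℝ (Fin 3))))))
    (hsl : ∀ᵐ τ : ℝ ∂(volume.restrict (Iio 0)), p' τ =ᵐ[volume] p τ) :
    IsSuitableWeakSolutionOn (slab (EuclideanSpace ℝ (Fin 3)) (Set.Iio 0) isOpen_Iio) 0 0 u p' ∧
      HasWeakSpatialGradientOn (slab (EuclideanSpace ℝ (Fin 3)) (Set.Iio 0) isOpen_Iio) u H ∧
      (∀ a : ℝ, 0 < a →
        ENNReal.ofReal (a ^ (2 * ρ)) * cknA a (0 : ℝ × EuclideanSpace ℝ (Fin 3)) u +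
              ENNReal.ofReal (a ^ ρ) * cknE a (0 : ℝ × EuclideanSpace ℝ (Fin 3)) H +
            ENNReal.ofReal (a ^ (2 * ρ)) * cknD a (0 : ℝ × EuclideanSpace ℝ (Fin 3)) p' ≤ (c : ℝ≥0∞)) := by
  have hQ : ((slab (EuclideanSpace ℝ (Fin 3)) (Iio 0) isOpen_Iio : TopologicalSpace.Opens (ℝ × EuclideanSpace ℝ (Fin 3))) :
      Set (ℝ × EuclideanSpace ℝ (Fin 3))) = Iio (0 : ℝ) ×ˢ univ := coe_slab _ _
  have hpm : AEStronglyMeasurable (uncurry p) (volume.restrict (Iio (0 : ℝ) ×ˢ (univ : Set (EuclideanSpace ℝ (Fin 3))))) := by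
    have h := hcls.1.distributional.2.2.1.aestronglyMeasurable
    rwa [hQ] at h
  exact inClass_congr_pressure_ae hcls (ae_eq_slab_of_ae_ae_eq_slice hpm hp'm hsl)


end Summit.NavierStokesRegularity.NavierStokesRegularity.Theorems.PowerGaugeEulerLiouville.PressureSwap

end
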